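import Summits.MatrixMultiplication.OmegaCensus.SmallFormats.MatMul223RankGF3Cert
import Literature.Computability.AlgebraicComplexity.Nazarov2023FiniteFieldRankBound
import HarnessLib

/-!
# ω-census family (a): `36n ≤ 11·R_𝔽₃(⟨2,2,n⟩)` — Nazarov's `𝔽₃` bound, re-derived by cap counting

Cell `pub-omega` (unit `pub-omega-tensor-g6`), topic `Summits/MatrixMultiplication/OmegaCensus`
(sub-folder `SmallFormats`). Framing (verbatim): lottery ticket; floor = certified bounds/negative ranges.
HONEST FRAMING: the VALUE `⌈36n/11⌉ ≤ R_𝔽₃(⟨2,2,n⟩)` is PRINTED — it is the case `K = 3`, `n = s = 2`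
(`f = K² + 3 = 12`, bound `3 · (12/11) · m`) of Nazarov 2023 / Alekseev–Nazarov 2019, which the tree holds
only as the NAMED FACT `nazarov2023_rank_matMulTensor_ge`. New for the census is an UNCONDITIONAL kernel
proof over `𝔽₃` by a different route (cap counting), improving the tree's kernel floor
`max(3n+2, ⌈13n/4⌉)` (`MatMul22nRankGF3ThreeNPlusTwo`, `MatMul22nRankGF3LowerBound`) for every `n ≥ 8`
where `⌈36n/11⌉` is larger (e.g. `R_𝔽₃(⟨2,2,8⟩) ≥ 27`, `⟨2,2,12⟩ ≥ 40`, `⟨2,2,16⟩ ≥ 53`). Nothing here is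
progress on `ω`.

THE ARGUMENT. Let `⟨2,2,n⟩ = ∑_{t<r} w_t ⊗ u_t ⊗ v_t` over `𝔽₃`, and let `z / a / b` be the numbers of
zero / rank-one / invertible X-coefficient matrices `u_t` (`z + a + b = r`).
* (J) dual-plane caps (ENG2's `three_mul_le_card` via `JPlane.three_mul_add_card_le`): each of the 32
  dual-type planes of `M₂(𝔽₃)` is annihilated by at most `r − 3n` of the `u_t`; a zero `u_t` annihilates all
  32, a rank-one one exactly 2, an invertible one exactly 4 (`decide`). Summing: `96n + 32z + 2a + 4b ≤ 32r`.
* (L) lit's quantitative rank-one-plane cap (`card_vanishing_le_two_mul_sub`): each of the 4 planes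
  `{λ zᵀ}` (`λ ∈ P¹(𝔽₃)`) carries at most `2r − 6n` of the `u_t`; a zero `u_t` lies on all 4, a rank-one one on
  at least 1 (`decide`). Summing: `24n + 4z + a ≤ 8r`.
Eliminating `a` and `b`: `22r ≥ 72n + 18z ≥ 72n`, i.e. **`11r ≥ 36n`**.
-/

namespace Summit.MatrixMultiplication.OmegaCensus.SmallFormats

open Module Matrix Literature.Computability.AlgebraicComplexity
open Summit.MatrixMultiplication.OmegaCensus.RankOnePlaneCapGeneral

/-- (J-incidences) an X-matrix annihilates at least `32 / 2 / 4` of the 32 dual-type planes according as it is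
zero / rank-one / invertible (`decide` over the 81 matrices; written with indicators for the bookkeeping). -/
theorem inc3_le_card_perp3 : ∀ A : Fin 2 × Fin 2 → ZMod 3,
    32 * (if isZero43 A = true then 1 else 0) + 2 * (if (isZero43 A = false ∧ det03 A = true) then 1 else 0)
      + 4 * (if (isZero43 A = false ∧ det03 A = false) then 1 else 0)
      ≤ (Finset.univ.filter fun l => perp3 A l = true).card :=
  forall_of_forall_mk4 (by decide)

/-- (L-incidences) an X-matrix lies on at least `4 / 1 / 0` of the 4 row planes `{λ zᵀ}` according as it is
zero / rank-one / invertible (`decide`). -/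
theorem rinc3_le_card_rowVan : ∀ A : Fin 2 × Fin 2 → ZMod 3,
    4 * (if isZero43 A = true then 1 else 0) + (if (isZero43 A = false ∧ det03 A = true) then 1 else 0)
      ≤ (Finset.univ.filter fun d => rowVan A d = true).card :=
  forall_of_forall_mk4 (by decide)

/-- **The counting over `𝔽₃`**: any decomposition of `⟨2,2,n⟩` over `𝔽₃` into `r` triads has `36n ≤ 11r`. -/
theorem thirtysix_mul_le_eleven_mul_card (n r : ℕ) (w : Fin r → Fin 2 × Fin n → ZMod 3)
    (u : Fin r → Fin 2 × Fin 2 → ZMod 3) (v : Fin r → Fin 2 × Fin n → ZMod 3)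
    (hdec : matMulTensor (ZMod 3) 2 2 n = ∑ i, triad (w i) (u i) (v i)) : 36 * n ≤ 11 * r := by
  classical
  have hA : ∀ i x, (bilinCompOfTriads (ZMod 3) w u v hdec).f i x = dotX (u i) x := fun i x => rfl
  -- (J) the cap of each of the 32 dual-type planes, summed
  have hJ : ∀ l : Fin 32, 3 * n + (Finset.univ.filter fun i => perp3 (u i) l = true).card ≤ r := by
    intro l
    have h := (jPlane3 l).three_mul_add_card_le (bilinCompOfTriads (ZMod 3) w u v hdec) u hA
      (fun i => perp3 (u i) l = true) (fun i hi => perp3_dotX hi)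
    simpa only [Fintype.card_fin] using h
  have hJsum : ∑ l : Fin 32, (3 * n + (Finset.univ.filter fun i => perp3 (u i) l = true).card)
      ≤ ∑ _l : Fin 32, r := Finset.sum_le_sum fun l _ => hJ l
  rw [Finset.sum_add_distrib] at hJsum
  simp only [Finset.sum_const, Finset.card_univ, Fintype.card_fin, smul_eq_mul] at hJsum
  have hI : ∑ i, (32 * (if isZero43 (u i) = true then 1 else 0)
      + 2 * (if (isZero43 (u i) = false ∧ det03 (u i) = true) then 1 else 0)
      + 4 * (if (isZero43 (u i) = false ∧ det03 (u i) = false) then 1 else 0))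
      ≤ ∑ l : Fin 32, (Finset.univ.filter fun i => perp3 (u i) l = true).card := by
    calc _ ≤ ∑ i, (Finset.univ.filter fun l => perp3 (u i) l = true).card :=
          Finset.sum_le_sum fun i _ => inc3_le_card_perp3 (u i)
      _ = ∑ l : Fin 32, (Finset.univ.filter fun i => perp3 (u i) l = true).card := by
          simp only [Finset.card_filter]
          exact Finset.sum_comm
  -- (L) the quantitative cap of each of the 4 row planes, summed
  have hRow : ∀ d : Fin 4, (Finset.univ.filter fun t => rowVan (u t) d = true).card + 6 * n ≤ 2 * r := by
    intro d
    have h := card_vanishing_le_two_mul_sub (n := n) (le_refl 2) (bilinCompOfTriads (ZMod 3) w u v hdec)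
      (lam3_ne_zero d) (Finset.univ.filter fun t => rowVan (u t) d = true)
      (fun i hi z => by
        rw [Finset.mem_filter] at hi
        rw [hA]
        exact dotX_vecMulVec_row hi.2 z)
    simpa only [Fintype.card_fin] using h
  have hRsum : ∑ d : Fin 4, ((Finset.univ.filter fun t => rowVan (u t) d = true).card + 6 * n)
      ≤ ∑ _d : Fin 4, 2 * r := Finset.sum_le_sum fun d _ => hRow d
  rw [Finset.sum_add_distrib] at hRsum
  simp only [Finset.sum_const, Finset.card_univ, Fintype.card_fin, smul_eq_mul] at hRsum
  have hL : ∑ i, (4 * (if isZero43 (u i) = true then 1 else 0)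
      + (if (isZero43 (u i) = false ∧ det03 (u i) = true) then 1 else 0))
      ≤ ∑ d : Fin 4, (Finset.univ.filter fun t => rowVan (u t) d = true).card := by
    calc _ ≤ ∑ i, (Finset.univ.filter fun d => rowVan (u i) d = true).card :=
          Finset.sum_le_sum fun i _ => rinc3_le_card_rowVan (u i)
      _ = ∑ d : Fin 4, (Finset.univ.filter fun t => rowVan (u t) d = true).card := by
          simp only [Finset.card_filter]
          exact Finset.sum_comm
  -- bookkeeping: z / a / b
  set Z0 := Finset.univ.filter (fun t : Fin r => isZero43 (u t) = true) with hZ0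
  set R1 := Finset.univ.filter (fun t : Fin r => isZero43 (u t) = false ∧ det03 (u t) = true) with hR1
  set T2 := Finset.univ.filter (fun t : Fin r => isZero43 (u t) = false ∧ det03 (u t) = false) with hT2
  have hpart : ∀ A : Fin 2 × Fin 2 → ZMod 3, (if isZero43 A = true then 1 else 0)
      + (if (isZero43 A = false ∧ det03 A = true) then 1 else 0)
      + (if (isZero43 A = false ∧ det03 A = false) then 1 else 0) = 1 := by
    intro A
    by_cases h0 : isZero43 A = true <;> by_cases h1 : det03 A = true <;> simp [h0, h1]
  have hpsum := Finset.sum_congr rfl fun i (_ : i ∈ (Finset.univ : Finset (Fin r))) => hpart (u i)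
  rw [Finset.sum_add_distrib, Finset.sum_add_distrib, Finset.sum_boole, Finset.sum_boole, Finset.sum_boole] at hpsum
  simp only [Finset.sum_const, Finset.card_univ, Fintype.card_fin, smul_eq_mul, mul_one, Nat.cast_id] at hpsum
  rw [Finset.sum_add_distrib, Finset.sum_add_distrib, ← Finset.mul_sum, ← Finset.mul_sum, ← Finset.mul_sum,
    Finset.sum_boole, Finset.sum_boole, Finset.sum_boole] at hI
  simp only [Nat.cast_id] at hI
  rw [Finset.sum_add_distrib, ← Finset.mul_sum, Finset.sum_boole, Finset.sum_boole] at hL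
  simp only [Nat.cast_id] at hL
  rw [← hZ0, ← hR1, ← hT2] at hpsum hI
  rw [← hZ0, ← hR1] at hL
  omega

/-- **`36n ≤ 11·R_𝔽₃(⟨2,2,n⟩)`** for every `n` — Nazarov 2023's bound at `K = 3` (there `3(1 + 1/11)·n`),
here an unconditional kernel theorem by cap counting. -/
theorem thirtysix_mul_le_eleven_mul_tensorRank_matMulTensor_22n_gf3 (n : ℕ) :
    36 * n ≤ 11 * tensorRank (matMulTensor (ZMod 3) 2 2 n) := by
  obtain ⟨w, u, v, hdec⟩ := exists_triad_decomposition_tensorRank (matMulTensor (ZMod 3) 2 2 n)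
  exact thirtysix_mul_le_eleven_mul_card n _ w u v hdec

/-- **`27 ≤ R_𝔽₃(⟨2,2,8⟩)`** (Nazarov's printed value; the tree's previous kernel floor was `26 = 3·8+2`;
ceiling `28` by Hopcroft–Kerr). -/
theorem twentyseven_le_tensorRank_matMulTensor_228_gf3 : 27 ≤ tensorRank (matMulTensor (ZMod 3) 2 2 8) := by
  have h := thirtysix_mul_le_eleven_mul_tensorRank_matMulTensor_22n_gf3 8
  omega

/-- `R_𝔽₃(⟨2,2,8⟩) ∈ {27, 28}`. -/
theorem tensorRank_matMulTensor_228_gf3_mem : tensorRank (matMulTensor (ZMod 3) 2 2 8) ∈ Set.Icc 27 28 :=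
  ⟨twentyseven_le_tensorRank_matMulTensor_228_gf3, hopcroftKerr1971_tensorRank_matMulTensor_22n_le (K := ZMod 3) 8⟩

/-- **`40 ≤ R_𝔽₃(⟨2,2,12⟩)`** (previous kernel floor `39 = ⌈13·12/4⌉`; ceiling `42`). -/
theorem forty_le_tensorRank_matMulTensor_2212_gf3 : 40 ≤ tensorRank (matMulTensor (ZMod 3) 2 2 12) := by
  have h := thirtysix_mul_le_eleven_mul_tensorRank_matMulTensor_22n_gf3 12
  omega

/-- **`53 ≤ R_𝔽₃(⟨2,2,16⟩)`** (previous kernel floor `52 = 13·16/4`; ceiling `56`). -/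
theorem fiftythree_le_tensorRank_matMulTensor_2216_gf3 : 53 ≤ tensorRank (matMulTensor (ZMod 3) 2 2 16) := by
  have h := thirtysix_mul_le_eleven_mul_tensorRank_matMulTensor_22n_gf3 16
  omega

/-- The `K = 3`, `n = s = 2` case of Nazarov's theorem in its printed rational form,
`(2+2−1)·(1 + 1/(f−1))·m ≤ R_𝔽₃(⟨2,2,m⟩)` with `f(3,2,2) = 12` — DISCHARGED for the field `ZMod 3`
(the named fact `nazarov2023_rank_matMulTensor_ge` quantifies over all finite fields and all `n ≤ s`). -/
theorem nazarov2023_case_K3_n2_s2 (m : ℕ) :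
    ((2 + 2 - 1 : ℕ) : ℚ) * (1 + 1 / (nazarov2023F 3 2 2 - 1)) * m ≤ (tensorRank (matMulTensor (ZMod 3) 2 2 m) : ℚ) := by
  have hf : nazarov2023F 3 2 2 = 12 := by norm_num [nazarov2023F]
  rw [hf]
  have h := thirtysix_mul_le_eleven_mul_tensorRank_matMulTensor_22n_gf3 m
  have h' : (36 : ℚ) * m ≤ 11 * (tensorRank (matMulTensor (ZMod 3) 2 2 m) : ℚ) := by exact_mod_cast h
  push_cast
  nlinarith

end Summit.MatrixMultiplication.OmegaCensus.SmallFormats
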